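import Summits.QuantumAdvantage.AdviceFreeQNC0.CodegTwoSyndrome
import HarnessLib

/-!
# Cell qa-qnc0 (rung F-S1, route RingFrame, crux α, line `tensor`): R1U at co-degree three, part 1 —
# the order-`≤ 3` syndrome of `RM(m−4, m)`, the quadratic layer (moment matrices of rank `≤ 7`,
# Meshulam) and the coordinate count

Planner qa-qnc0-p2's ROUND-5 THEOREM E3 (`LiftOneUCodegThree : LiftOneUAt 4 7`; ask R5-f) bounds the lift
cost of a LIGHT row system modulo `RM(d, d+4)` (co-degree `e = 3`, `f = 16`, radius `w ≤ 8`).  As in the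
co-degree-two files (`CodegTwoSyndrome`/`CodegTwoRows`/`CodegTwo`, prover gen 6) the proof is a DIMENSION
count of the row-syndrome space; this file supplies the syndrome and the two lower layers:

* `Syndrome3.syn3` — the order-`≤ 3` syndrome `g ↦ (Σ_v g(v)·x_J(v))_{|J| ≤ 3}`; **`ker syn3 = RM(d, d+4)`**
  (`ker_syn3_eq_lowDeg`; `⊆` by Reed–Muller duality `SketchLAR.stub_orth_le_lowDeg`).
* `Syndrome3.momMat_syn3_indF` — the moment matrix (`Syndrome2.momMat`, order-`≤ 2` coordinates) of the
  syndrome of a point set `a` is `Σ_{v ∈ a} v vᵀ`; `indF_mem_lowDeg_of_low_eq_zero`: if all coordinates of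
  order `≤ 2` vanish then `𝟙_a ∈ RM(m−3, m)` (duality again).
* `Syndrome3.rank_sum_vecMulVec_le` — **a point set `a` with zero point-sum has `rank (Σ_{v∈a} v vᵀ) ≤ |a| − 1`**
  (`Σ v vᵀ = Mᵀ M` for the `|a| × m` point matrix `M`, whose rows are dependent); hence `≤ 7` for
  `|a| ≤ 8` (`rank_momMat_le_seven`).
* `Syndrome3.finrank_le_mul_of_rank_le` — MESHULAM for a space of order-`≤ 2` syndromes with zero parity
  and moment matrices of rank `≤ r`: `dim ≤ r·m` (`Literature.LinearAlgebra.Meshulam1985_exists_rank_gt_holds`).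
* `Syndrome3.low2`, `finrank_le_of_low` — restriction to the order-`≤ 2` coordinates, and the COORDINATE
  COUNT `dim K ≤ #{J : |J| ≤ 3} ≤ Σ_{j<4} C(m,j)` for any space of syndromes vanishing beyond order `3`.

Parts 2–3 (`CodegThreeTop.lean`: the top layer = 3-flat leaders, clique lemma, Chow's star/top via
`Literature.LinearAlgebra.Subspace.grassmannClique_star_or_top`; `CodegThree.lean`: rows, transversal,
THEOREM E3).  The cell's lemmas (planner qa-qnc0-p2 gen 5 ROUND-5 §2.3; seat qa-qnc0-lit gen 11,
2026-08-27).  WHAT THIS IS NOT: nothing on co-degree `≥ 4`, `LiftOneU`, α or the separation.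

## References

* R. Meshulam, *On the maximal rank in a subspace of matrices*, Quart. J. Math. Oxford 36 (1985) 225–229,
  Thm 2 [Meshulam1985] (through `Meshulam1985_exists_rank_gt_holds`).
-/

noncomputable section

namespace Summit.QuantumAdvantage.AdviceFreeQNC0

open Finset Module
open Literature.Computability.MetaComplexity Literature.Computability.MetaComplexity.Smolensky
open Syndrome2

namespace Syndrome3

variable {m : ℕ}

/-! ### The order-`≤ 3` syndrome -/

/-- **The order-`≤ 3` syndrome**: `syn3 g J = Σ_v g(v)·x_J(v)` for `|J| ≤ 3`, and `0` for `|J| > 3`. -/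
def syn3 : CubeFn (ZMod 2) m →ₗ[ZMod 2] (Finset (Fin m) → ZMod 2) where
  toFun g J := if J.card ≤ 3 then ∑ v, g v * mono (ZMod 2) J v else 0
  map_add' g h := by
    funext J
    simp only [Pi.add_apply]
    split_ifs with hJ
    · rw [← Finset.sum_add_distrib]
      exact Finset.sum_congr rfl fun v _ => by ring
    · rw [add_zero]
  map_smul' c g := by
    funext J
    simp only [Pi.smul_apply, smul_eq_mul, RingHom.id_apply]
    split_ifs with hJ
    · rw [Finset.mul_sum]
      exact Finset.sum_congr rfl fun v _ => by ring
    · rw [mul_zero]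

/-- Unfolding lemma. -/
theorem syn3_apply (g : CubeFn (ZMod 2) m) (J : Finset (Fin m)) :
    syn3 g J = if J.card ≤ 3 then ∑ v, g v * mono (ZMod 2) J v else 0 := rfl

/-- On a small index set the syndrome is the pairing with the monomial. -/
theorem syn3_apply_of_le (g : CubeFn (ZMod 2) m) {J : Finset (Fin m)} (hJ : J.card ≤ 3) :
    syn3 g J = ∑ v, g v * mono (ZMod 2) J v := by
  rw [syn3_apply, if_pos hJ]

/-- The syndrome vanishes beyond order `3`. -/
theorem syn3_apply_of_gt (g : CubeFn (ZMod 2) m) {J : Finset (Fin m)} (hJ : ¬ J.card ≤ 3) :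
    syn3 g J = 0 := by
  rw [syn3_apply, if_neg hJ]

/-- `RM(d, d+4) ≤ ker syn3`: a degree-`≤ d` function times a monomial of degree `≤ 3` has degree
`≤ d + 3 < d + 4`, hence even weight. -/
theorem lowDeg_le_ker_syn3 (d : ℕ) :
    lowDeg (ZMod 2) (d + 4) d ≤ LinearMap.ker (syn3 (m := d + 4)) := by
  intro g hg
  rw [LinearMap.mem_ker]
  funext J
  rw [Pi.zero_apply, syn3_apply]
  split_ifs with hJ
  · have hmem : (g * mono (ZMod 2) J) ∈ lowDeg (ZMod 2) (d + 4) (d + 3) :=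
      mul_mem_lowDeg_add hg (mono_mem_lowDeg hJ)
    have h := sum_univ_eq_zero_of_mem_lowDeg hmem (by omega)
    simpa only [Pi.mul_apply] using h
  · rfl

/-- **Duality step**: a function all of whose pairings with monomials of degree `≤ k` vanish lies in
`RM(m − k − 1, m)` (`k + k' + 1 = m`). -/
theorem mem_lowDeg_of_orth {k k' : ℕ} (hkk' : k + k' + 1 = m) (g : CubeFn (ZMod 2) m)
    (h : ∀ J : Finset (Fin m), J.card ≤ k → ∑ v, g v * mono (ZMod 2) J v = 0) :
    g ∈ lowDeg (ZMod 2) m k' := by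
  refine Summit.QuantumAdvantage.DigitPolyUniformity.SketchLAR.stub_orth_le_lowDeg hkk' g fun f hf => ?_
  rw [lowDeg_eq_span] at hf
  induction hf using Submodule.span_induction with
  | mem f hf =>
    obtain ⟨⟨J, hJ⟩, rfl⟩ := hf
    exact h J hJ
  | zero => simp
  | add f f' _ _ hf hf' =>
    simp only [Pi.add_apply, mul_add, Finset.sum_add_distrib, hf, hf', add_zero]
  | smul c f _ hf =>
    simp only [Pi.smul_apply, smul_eq_mul]
    calc ∑ b, g b * (c * f b) = c * ∑ b, g b * f b := by
          rw [Finset.mul_sum]; exact Finset.sum_congr rfl fun b _ => by ring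
      _ = 0 := by rw [hf, mul_zero]

/-- `ker syn3 ≤ RM(d, d+4)` (Reed–Muller duality). -/
theorem ker_syn3_le_lowDeg (d : ℕ) :
    LinearMap.ker (syn3 (m := d + 4)) ≤ lowDeg (ZMod 2) (d + 4) d := by
  intro g hg
  rw [LinearMap.mem_ker] at hg
  refine mem_lowDeg_of_orth (k := 3) (by omega) g fun J hJ => ?_
  have h := congrFun hg J
  rw [Pi.zero_apply, syn3_apply_of_le g hJ] at h
  exact h

/-- **`ker syn3 = RM(d, d+4)`.** -/
theorem ker_syn3_eq_lowDeg (d : ℕ) :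
    LinearMap.ker (syn3 (m := d + 4)) = lowDeg (ZMod 2) (d + 4) d :=
  le_antisymm (ker_syn3_le_lowDeg d) (lowDeg_le_ker_syn3 d)

/-! ### Point sets: moments of order `≤ 2`, and the top layer lies in `RM(m−3, m)` -/

/-- **The moment matrix of a point set**: `momMat (syn3 𝟙_a) = Σ_{v ∈ a} v vᵀ`. -/
theorem momMat_syn3_indF (a : Finset (Fin m → Bool)) :
    momMat (syn3 (indF a)) = ∑ v ∈ a, Matrix.vecMulVec (bvec v) (bvec v) := by
  ext i j
  rw [momMat_apply, syn3_apply_of_le _ ((card_pair_le i j).trans (by norm_num)), sum_indF_mul,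
    Matrix.sum_apply]
  refine Finset.sum_congr rfl fun v _ => ?_
  rw [Matrix.vecMulVec_apply, mono_eq_prod_bvec]
  by_cases hij : i = j
  · subst hij
    rw [Finset.insert_eq_of_mem (Finset.mem_singleton_self _), Finset.prod_singleton]
    unfold bvec
    cases v i <;> simp
  · rw [Finset.prod_pair hij]

/-- The parity coordinate of a point set: `syn3 𝟙_a ∅ = |a|`. -/
theorem syn3_indF_empty (a : Finset (Fin m → Bool)) : syn3 (indF a) ∅ = (a.card : ZMod 2) := by
  rw [syn3_apply_of_le _ (by simp), sum_indF_mul]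
  simp [mono_eq_prod_bvec]

/-- The point-sum coordinates of a point set: `syn3 𝟙_a {i} = Σ_{v ∈ a} v_i`. -/
theorem syn3_indF_singleton (a : Finset (Fin m → Bool)) (i : Fin m) :
    syn3 (indF a) {i} = ∑ v ∈ a, bvec v i := by
  rw [syn3_apply_of_le _ (by simp), sum_indF_mul]
  simp [mono_eq_prod_bvec]

/-- **Top layer lies in `RM(m−3, m)`**: if all coordinates of order `≤ 2` of `syn3 𝟙_a` vanish
(`m ≥ 3`), then `𝟙_a` has degree `≤ m − 3`. -/
theorem indF_mem_lowDeg_of_low_eq_zero (hm : 3 ≤ m) (a : Finset (Fin m → Bool))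
    (h : ∀ J : Finset (Fin m), J.card ≤ 2 → syn3 (indF a) J = 0) :
    indF a ∈ lowDeg (ZMod 2) m (m - 3) := by
  refine mem_lowDeg_of_orth (k := 2) (by omega) (indF a) fun J hJ => ?_
  have h' := h J hJ
  rwa [syn3_apply_of_le _ (hJ.trans (by norm_num))] at h'

/-! ### The rank of the moment matrix of a zero-sum point set -/

/-- **RANK LEMMA**: a non-empty point set `a` with zero point-sum has `rank (Σ_{v ∈ a} v vᵀ) ≤ |a| − 1`:
`Σ v vᵀ = Mᵀ M` for the `|a| × m` matrix `M` of points, and the image of `M` lies in the hyperplane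
`{x : Σ_r x_r = 0}` because the rows of `M` sum to zero. [folklore] -/
theorem rank_sum_vecMulVec_le (a : Finset (Fin m → Bool)) (hne : a.Nonempty)
    (hσ : ∀ i, ∑ v ∈ a, bvec v i = 0) :
    (∑ v ∈ a, Matrix.vecMulVec (bvec v) (bvec v)).rank ≤ a.card - 1 := by
  classical
  set M : Matrix ↥a (Fin m) (ZMod 2) := Matrix.of fun r i => bvec r.1 i with hM
  have hfac : ∑ v ∈ a, Matrix.vecMulVec (bvec v) (bvec v) = M.transpose * M := by
    ext i j
    rw [Matrix.sum_apply, Matrix.mul_apply]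
    simp only [Matrix.vecMulVec_apply, Matrix.transpose_apply, hM, Matrix.of_apply]
    exact (Finset.sum_coe_sort a (fun v => bvec v i * bvec v j)).symm
  rw [hfac]
  refine (Matrix.rank_mul_le_right _ _).trans ?_
  -- `rank M ≤ |a| - 1`: the range of `M` lies in the kernel of the sum functional
  set σ : (↥a → ZMod 2) →ₗ[ZMod 2] ZMod 2 :=
    { toFun := fun x => ∑ r, x r
      map_add' := fun x y => by simp [Finset.sum_add_distrib]
      map_smul' := fun c x => by simp [Finset.mul_sum] } with hσdef
  have hrange : LinearMap.range M.mulVecLin ≤ LinearMap.ker σ := by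
    rintro _ ⟨y, rfl⟩
    rw [LinearMap.mem_ker]
    show ∑ r : ↥a, (M.mulVec y) r = 0
    simp only [Matrix.mulVec, dotProduct, hM, Matrix.of_apply]
    rw [Finset.sum_comm]
    refine Finset.sum_eq_zero fun i _ => ?_
    rw [← Finset.sum_mul, Finset.sum_coe_sort a (fun v => bvec v i), hσ i, zero_mul]
  have hker : finrank (ZMod 2) (LinearMap.ker σ) + 1 = a.card := by
    have h := LinearMap.finrank_range_add_finrank_ker σ
    have htop : LinearMap.range σ = ⊤ := by
      obtain ⟨v₀, hv₀⟩ := hne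
      refine LinearMap.range_eq_top.2 fun c => ⟨Pi.single ⟨v₀, hv₀⟩ c, ?_⟩
      show ∑ r, Pi.single (M := fun _ => ZMod 2) (⟨v₀, hv₀⟩ : ↥a) c r = c
      rw [Finset.sum_pi_single']
      simp
    rw [htop, finrank_top, Module.finrank_self, Module.finrank_fintype_fun_eq_card,
      Fintype.card_coe] at h
    omega
  unfold Matrix.rank
  have := Submodule.finrank_mono hrange
  omega

/-- Hence a point set of size `≤ 8` with zero point-sum has moment matrix of rank `≤ 7`. -/
theorem rank_momMat_le_seven (a : Finset (Fin m → Bool)) (h8 : a.card ≤ 8)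
    (hσ : ∀ i, ∑ v ∈ a, bvec v i = 0) :
    (∑ v ∈ a, Matrix.vecMulVec (bvec v) (bvec v)).rank ≤ 7 := by
  rcases a.eq_empty_or_nonempty with rfl | hne
  · rw [Finset.sum_empty, Matrix.rank_zero]; exact Nat.zero_le _
  · have := rank_sum_vecMulVec_le a hne hσ
    omega

/-! ### Meshulam for a space of order-`≤ 2` syndromes of bounded rank -/

/-- **Meshulam's bound, rank `≤ r`**: a linear space `K` of syndromes with zero parity, vanishing beyond
order `2`, all of whose moment matrices have rank `≤ r`, has `dim K ≤ r·m` (the moment matrix embeds `K`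
into a space of `m × m` matrices of rank `≤ r`; Meshulam 1985 Thm 2). [cite: Meshulam1985, Thm 2] -/
theorem finrank_le_mul_of_rank_le (r : ℕ) (K : Submodule (ZMod 2) (Finset (Fin m) → ZMod 2))
    (h0 : ∀ s ∈ K, s ∅ = 0) (hbig : ∀ s ∈ K, ∀ J : Finset (Fin m), ¬ J.card ≤ 2 → s J = 0)
    (hrank : ∀ s ∈ K, (momMat s).rank ≤ r) : finrank (ZMod 2) K ≤ r * m := by
  set f : K →ₗ[ZMod 2] Matrix (Fin m) (Fin m) (ZMod 2) := momMat.domRestrict K with hf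
  have hinj : Function.Injective f := by
    rw [← LinearMap.ker_eq_bot, Submodule.eq_bot_iff]
    intro s hs
    rw [LinearMap.mem_ker] at hs
    have h : (s : Finset (Fin m) → ZMod 2) = 0 :=
      eq_zero_of_momMat_eq_zero (h0 s s.2) (hbig s s.2) hs
    exact Subtype.ext h
  rw [← LinearMap.finrank_range_of_inj hinj]
  refine Literature.LinearAlgebra.finrank_le_mul_of_forall_rank_le
    (Literature.LinearAlgebra.Meshulam1985_exists_rank_gt_holds (ZMod 2)) (LinearMap.range f)
    fun A hA => ?_
  obtain ⟨s, rfl⟩ := LinearMap.mem_range.1 hA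
  exact hrank s s.2

/-! ### Restriction to order `≤ 2`, and the coordinate count -/

/-- restriction of a syndrome to its coordinates of order `≤ 2` (zero elsewhere). -/
def low2 : (Finset (Fin m) → ZMod 2) →ₗ[ZMod 2] (Finset (Fin m) → ZMod 2) where
  toFun s J := if J.card ≤ 2 then s J else 0
  map_add' s t := by
    funext J; simp only [Pi.add_apply]; split_ifs <;> simp
  map_smul' c s := by
    funext J; simp only [Pi.smul_apply, smul_eq_mul, RingHom.id_apply]; split_ifs <;> simp

/-- Unfolding lemma. -/
theorem low2_apply (s : Finset (Fin m) → ZMod 2) (J : Finset (Fin m)) :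
    low2 s J = if J.card ≤ 2 then s J else 0 := rfl

/-- The moment matrix only reads coordinates of order `≤ 2`. -/
theorem momMat_low2 (s : Finset (Fin m) → ZMod 2) : momMat (low2 s) = momMat s := by
  ext i j
  rw [momMat_apply, momMat_apply, low2_apply, if_pos (card_pair_le i j)]

/-- `low2 s = 0` iff all coordinates of order `≤ 2` of `s` vanish. -/
theorem low2_eq_zero_iff (s : Finset (Fin m) → ZMod 2) :
    low2 s = 0 ↔ ∀ J : Finset (Fin m), J.card ≤ 2 → s J = 0 := by
  constructor
  · intro h J hJ
    have := congrFun h J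
    rwa [low2_apply, if_pos hJ] at this
  · intro h
    funext J
    rw [low2_apply, Pi.zero_apply]
    split_ifs with hJ
    · exact h J hJ
    · rfl

/-- functions supported on a finset `T` of coordinates. -/
def suppOn {α : Type*} (T : Finset α) : Submodule (ZMod 2) (α → ZMod 2) where
  carrier := {s | ∀ J, J ∉ T → s J = 0}
  add_mem' := by
    intro s t hs ht J hJ
    simp [hs J hJ, ht J hJ]
  zero_mem' := by intro J _; rfl
  smul_mem' := by
    intro c s hs J hJ
    simp [hs J hJ]

/-- **`dim (functions supported on T) ≤ #T`**: such functions are the extensions by zero of functions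
on `T`. [folklore] -/
theorem finrank_suppOn_le {α : Type*} [Fintype α] [DecidableEq α] (T : Finset α) :
    finrank (ZMod 2) (suppOn T) ≤ T.card := by
  -- the extension-by-zero map `(T → 𝔽₂) → (α → 𝔽₂)` surjects onto `suppOn T`
  set ext : (↥T → ZMod 2) →ₗ[ZMod 2] (α → ZMod 2) :=
    { toFun := fun x J => if h : J ∈ T then x ⟨J, h⟩ else 0
      map_add' := fun x y => by
        funext J; simp only [Pi.add_apply]; split_ifs <;> simp
      map_smul' := fun c x => by
        funext J; simp only [Pi.smul_apply, smul_eq_mul, RingHom.id_apply]; split_ifs <;> simp }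
    with hext
  have hle : suppOn T ≤ LinearMap.range ext := by
    intro s hs
    refine ⟨fun J => s J.1, ?_⟩
    funext J
    show (if h : J ∈ T then s J else 0) = s J
    split_ifs with h
    · rfl
    · exact (hs J h).symm
  calc finrank (ZMod 2) (suppOn T) ≤ finrank (ZMod 2) (LinearMap.range ext) := Submodule.finrank_mono hle
    _ ≤ finrank (ZMod 2) (↥T → ZMod 2) := LinearMap.finrank_range_le ext
    _ = T.card := by rw [Module.finrank_fintype_fun_eq_card, Fintype.card_coe]

/-- The index sets of order `≤ 3` number at most `Σ_{j<4} C(m, j)`. [folklore] -/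
theorem card_filter_card_le_three_le :
    (univ.filter fun J : Finset (Fin m) => J.card ≤ 3).card ≤ ∑ j ∈ Finset.range 4, m.choose j := by
  have hsub : (univ.filter fun J : Finset (Fin m) => J.card ≤ 3) ⊆
      (Finset.range 4).biUnion fun j => Finset.powersetCard j (univ : Finset (Fin m)) := by
    intro J hJ
    rw [Finset.mem_filter] at hJ
    rw [Finset.mem_biUnion]
    exact ⟨J.card, Finset.mem_range.2 (by omega), Finset.mem_powersetCard.2 ⟨Finset.subset_univ _, rfl⟩⟩
  refine (Finset.card_le_card hsub).trans (Finset.card_biUnion_le.trans ?_)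
  refine Finset.sum_le_sum fun j _ => ?_
  rw [Finset.card_powersetCard, Finset.card_univ, Fintype.card_fin]

/-- **COORDINATE COUNT**: a space of syndromes vanishing beyond order `3` has dimension
`≤ Σ_{j<4} C(m, j)`. -/
theorem finrank_le_of_vanishing (K : Submodule (ZMod 2) (Finset (Fin m) → ZMod 2))
    (hbig : ∀ s ∈ K, ∀ J : Finset (Fin m), ¬ J.card ≤ 3 → s J = 0) :
    finrank (ZMod 2) K ≤ ∑ j ∈ Finset.range 4, m.choose j := by
  classical
  have hle : K ≤ suppOn (univ.filter fun J : Finset (Fin m) => J.card ≤ 3) := by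
    intro s hs J hJ
    rw [Finset.mem_filter] at hJ
    exact hbig s hs J fun h => hJ ⟨Finset.mem_univ _, h⟩
  exact (Submodule.finrank_mono hle).trans
    ((finrank_suppOn_le _).trans card_filter_card_le_three_le)

end Syndrome3

end Summit.QuantumAdvantage.AdviceFreeQNC0

end
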